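import Mathlib.GroupTheory.Abelianization.Defs
import Mathlib.Topology.Algebra.OpenSubgroup
import Mathlib.NumberTheory.Padics.HeightOneSpectrum
import Literature.NumberTheory.GaloisRepresentations.EulerSystem
import Literature.NumberTheory.GaloisRepresentations.ModNCyclotomicCharacter
import HarnessLib

/-!
# The cyclotomic levels `K(μ_{p^k}) · K(μ_{ℓ₁}) ⋯ K(μ_{ℓ_s})` of an Euler system

The standard instance of `Literature.NumberTheory.GaloisRepresentations.EulerSystemLevels`
(file `EulerSystem`): for a number field `K`, a prime `p` and usable primes `q` of `K` to which
pairwise distinct rational primes `ℓ_q ≠ p` below them are attached (for `K = ℚ`: `ℓ_q = q`),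
the tower with `K_∞`-direction `K(μ_{p^k})`, `k ≥ 0`, and tame levels `K(q) := K(μ_{ℓ_q})`
(`cyclotomicLevels`); over `ℚ` this is the tower `ℚ(μ_m)`, `m = p^k ℓ₁ ⋯ ℓ_s`, carrying Kato's
Euler system and the cyclotomic-unit Euler system (Rubin, *Euler Systems* (2000), Ch. III §2;
Rubin's PCMI lectures (2009), §4.1: `𝒩 = {n p^k}`), `cyclotomicLevelsRat`.  In particular the
structure `EulerSystemLevels` is inhabited by a genuine tower (non-vacuity of the definition
`IsEulerSystem`).

* `rootsOfUnityFixer K n = Gal(K̄/K(μ_n)) ≤ Γ_K`, the subgroup fixing all `n`-th roots of unity of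
  `K̄`; for `n ≠ 0` it is the kernel of the tree's mod-`n` cyclotomic character
  (`rootsOfUnityFixer_eq_ker`, `modNCyclotomicCharacter`), hence open (`isOpen_rootsOfUnityFixer`),
  with abelian quotient (`commutator_le_rootsOfUnityFixer`), and unramified at every finite place
  `v ∤ n` (`rootsOfUnityFixer_unramifiedAt`, from `modNCyclotomicCharacter_eq_one_of_mem_inertia`:
  `I_𝔓` acts trivially on `μ_n` for `𝔓 ∌ n`).
* `cyclotomicLevels K p ℓ primes … : EulerSystemLevels K ℕ` and
  `cyclotomicLevelsRat p S : EulerSystemLevels ℚ ℕ` (usable primes: `v ∉ S`, `v ≠ p`).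

All statements are proved; no named fact is introduced.

## References

* K. Rubin, *Euler Systems*, Annals of Math. Studies 147 (2000), Def. 2.1.1, Remark 2.1.4,
  Ch. III §2.1 (`ℚ(μ_m)`, `𝒦 = ℚ^{ab}`). [Rubin2000]
* J. Neukirch, *Algebraic Number Theory* (1999), Ch. I (10.3)–(10.4) (`K(μ_n)/K` is unramified at
  primes not dividing `n`). [NeukirchANT1999]
-/

noncomputable section

open Field IsDedekindDomain
open scoped NumberField Classical

universe u

namespace Literature.NumberTheory.GaloisRepresentations

/-! ## `Gal(K̄/K(μ_n))` -/

section Fixer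

variable (K : Type u) [Field K]

/-- **`Gal(K̄/K(μ_n))`**: the subgroup of `Γ_K` fixing every `n`-th root of unity of `K̄`, i.e.
every `t ∈ K̄` with `t ^ n = 1` (only `n ≠ 0` is used below; for `n = 0` the condition `t ^ 0 = 1`
holds for all `t`, so the value is the trivial subgroup — a harmless junk value).
Ref: Rubin, *Euler Systems* (2000), Ch. III §2.1; Neukirch, *Algebraic Number Theory* (1999),
Ch. I §10. [folklore] -/
def rootsOfUnityFixer (n : ℕ) : Subgroup (absoluteGaloisGroup K) where
  carrier := {σ | ∀ t : AlgebraicClosure K, t ^ n = 1 → σ • t = t}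
  one_mem' := fun t _ ↦ one_smul _ t
  mul_mem' := fun {σ τ} hσ hτ t ht ↦ by rw [mul_smul, hτ t ht, hσ t ht]
  inv_mem' := fun {σ} hσ t ht ↦ by rw [inv_smul_eq_iff, hσ t ht]

variable {K} in
/-- Membership in `rootsOfUnityFixer`. [folklore] -/
theorem mem_rootsOfUnityFixer_iff {n : ℕ} {σ : absoluteGaloisGroup K} :
    σ ∈ rootsOfUnityFixer K n ↔ ∀ t : AlgebraicClosure K, t ^ n = 1 → σ • t = t :=
  Iff.rfl

/-- `Gal(K̄/K(μ_1)) = Γ_K`. [folklore] -/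
@[simp]
theorem rootsOfUnityFixer_one : rootsOfUnityFixer K 1 = ⊤ := by
  refine Subgroup.ext fun σ ↦ ⟨fun _ ↦ Subgroup.mem_top σ, fun _ t ht ↦ ?_⟩
  rw [pow_one] at ht
  rw [ht, smul_one]

/-- `K(μ_m) ⊆ K(μ_n)` for `m ∣ n`: the fixers decrease along divisibility. [folklore] -/
theorem rootsOfUnityFixer_le_of_dvd {m n : ℕ} (h : m ∣ n) :
    rootsOfUnityFixer K n ≤ rootsOfUnityFixer K m := by
  intro σ hσ t ht
  obtain ⟨k, rfl⟩ := h
  exact hσ t (by rw [pow_mul, ht, one_pow])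

/-- For `n ≠ 0` (and `char K ∤ n`), `Gal(K̄/K(μ_n))` is the kernel of the mod-`n` cyclotomic
character `Γ_K → (ℤ/n)ˣ` (tree `modNCyclotomicCharacter`, `σ ζ = ζ^{χ_n(σ)}`).
Ref: Neukirch, *Algebraic Number Theory* (1999), Ch. I §10; Deligne–Serre (1974), 4.4. [folklore] -/
theorem rootsOfUnityFixer_eq_ker (n : ℕ) [NeZero n] [NeZero (n : K)] :
    rootsOfUnityFixer K n = (modNCyclotomicCharacter K n).ker := by
  refine Subgroup.ext fun σ ↦ ⟨fun hσ ↦ ?_, fun hσ t ht ↦ ?_⟩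
  · obtain ⟨ζ, hζ⟩ := HasEnoughRootsOfUnity.exists_primitiveRoot (AlgebraicClosure K) n
    rw [MonoidHom.mem_ker]
    ext
    rw [Units.val_one, ← Nat.cast_one]
    exact modNCyclotomicCharacter_eq_of_smul_eq_pow K n hζ σ (by rw [pow_one]; exact hσ ζ hζ.pow_eq_one)
  · rw [MonoidHom.mem_ker] at hσ
    rcases eq_or_ne n 1 with rfl | hn1
    · rw [pow_one] at ht
      rw [ht, smul_one]
    · rw [modNCyclotomicCharacter_spec K n σ t ht, hσ, Units.val_one, ZMod.val_one'' hn1, pow_one]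

/-- `Gal(K̄/K(μ_n))` is open (`K(μ_n)/K` is finite): the mod-`n` cyclotomic character is locally
constant. [folklore] -/
theorem isOpen_rootsOfUnityFixer (n : ℕ) [NeZero n] [NeZero (n : K)] :
    IsOpen (rootsOfUnityFixer K n : Set (absoluteGaloisGroup K)) := by
  rw [rootsOfUnityFixer_eq_ker]
  refine Subgroup.isOpen_of_mem_nhds _ (g := 1) ?_
  have h := modNCyclotomicCharacter_eventually_eq_one K n
  simpa [Filter.Eventually, MonoidHom.coe_ker, Set.preimage] using h

/-- `K(μ_n)/K` is abelian: `[Γ_K, Γ_K] ≤ Gal(K̄/K(μ_n))` (the quotient embeds in `(ℤ/n)ˣ`). [folklore] -/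
theorem commutator_le_rootsOfUnityFixer (n : ℕ) [NeZero n] [NeZero (n : K)] :
    commutator (absoluteGaloisGroup K) ≤ rootsOfUnityFixer K n := by
  rw [rootsOfUnityFixer_eq_ker]
  exact Abelianization.commutator_subset_ker _

/-- **`K(μ_n)/K` is unramified at `v ∤ n`:** if `n ∉ 𝔓` for the primes `𝔓` of `\bar ℤ_K` above
`v`, every inertia group `I_𝔓 ≤ Γ_K` fixes `μ_n` (the `n`-th roots of unity are distinct modulo
`𝔓`; tree `modNCyclotomicCharacter_eq_one_of_mem_inertia`).
Ref: Neukirch, *Algebraic Number Theory* (1999), Ch. I (10.3)–(10.4); Washington, *Cyclotomic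
Fields*, Prop. 2.3. [folklore] -/
theorem rootsOfUnityFixer_unramifiedAt [NumberField K] (n : ℕ) [NeZero n]
    {v : HeightOneSpectrum (𝓞 K)} (hn : ∀ 𝔓 ∈ v.primesAbove, (n : absIntegers (𝓞 K) K) ∉ 𝔓) :
    SubgroupIsUnramifiedAt K (rootsOfUnityFixer K n) v := by
  intro 𝔓 h𝔓 σ hσ
  haveI : 𝔓.IsPrime := h𝔓.1
  rw [rootsOfUnityFixer_eq_ker, MonoidHom.mem_ker]
  exact modNCyclotomicCharacter_eq_one_of_mem_inertia (hn 𝔓 h𝔓) hσ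

/-- `n ∉ 𝔓` for every `𝔓 ∣ v` as soon as `n ∉ v` (`𝔓 ∩ 𝓞 K = v`). [folklore] -/
theorem natCast_not_mem_of_mem_primesAbove [NumberField K] {n : ℕ} {v : HeightOneSpectrum (𝓞 K)}
    (hv : (n : 𝓞 K) ∉ v.asIdeal) {𝔓 : Ideal (absIntegers (𝓞 K) K)} (h𝔓 : 𝔓 ∈ v.primesAbove) :
    (n : absIntegers (𝓞 K) K) ∉ 𝔓 := by
  intro hmem
  apply hv
  have h1 : (n : 𝓞 K) ∈ 𝔓.under (𝓞 K) := by
    rw [Ideal.under_def, Ideal.mem_comap, map_natCast]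
    exact hmem
  rwa [← h𝔓.2.over] at h1

/-- `K(μ_n)/K` is unramified at every finite place `v` with `n ∉ v` (i.e. `v ∤ n`).
Ref: Neukirch, *Algebraic Number Theory* (1999), Ch. I (10.3)–(10.4). [folklore] -/
theorem rootsOfUnityFixer_unramifiedAt_of_not_mem [NumberField K] (n : ℕ) [NeZero n]
    {v : HeightOneSpectrum (𝓞 K)} (hv : (n : 𝓞 K) ∉ v.asIdeal) :
    SubgroupIsUnramifiedAt K (rootsOfUnityFixer K n) v :=
  rootsOfUnityFixer_unramifiedAt K n fun _ h𝔓 ↦ natCast_not_mem_of_mem_primesAbove K hv h𝔓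

end Fixer

/-! ## The cyclotomic levels over a number field -/

section Levels

variable (K : Type u) [Field K] [NumberField K] (p : ℕ) [Fact p.Prime]

/-- **The cyclotomic levels** `F_k(r) = K(μ_{p^k}) · ∏_{q ∈ r} K(μ_{ℓ_q})` of an Euler system over
the number field `K`: `K_∞`-direction `K(μ_{p^k})`, `k ≥ 0` (`F_0 = K`), tame level at the usable
prime `q` the field `K(μ_{ℓ_q})` for a chosen nonzero natural number `ℓ_q ∈ q` (the rational
prime below `q`), usable primes a set `primes` of places not above `p` such that `ℓ_q ∉ v` for
distinct usable `q, v` (distinct usable primes have distinct residue characteristics — automatic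
for `K = ℚ`, `cyclotomicLevelsRat`).  The axioms of `EulerSystemLevels` hold by
`isOpen_rootsOfUnityFixer`, `commutator_le_rootsOfUnityFixer`, `rootsOfUnityFixer_unramifiedAt`.
Ref: Rubin, *Euler Systems* (2000), Def. 2.1.1, Remark 2.1.4, Ch. III §2.1 (`K = ℚ`,
`𝒦 = ℚ^{ab} = ⋃ ℚ(μ_m)`); Rubin, PCMI lectures (2009), §4.1. [cite: Rubin2000, Ch. III §2.1] -/
def cyclotomicLevels (ℓ : HeightOneSpectrum (𝓞 K) → ℕ) (primes : Set (HeightOneSpectrum (𝓞 K)))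
    (hℓ : ∀ q, ℓ q ≠ 0) (hp : ∀ v ∈ primes, (p : 𝓞 K) ∉ v.asIdeal)
    (hℓv : ∀ q ∈ primes, ∀ v ∈ primes, v ≠ q → (ℓ q : 𝓞 K) ∉ v.asIdeal) :
    EulerSystemLevels K ℕ where
  primes := primes
  pLevel k := rootsOfUnityFixer K (p ^ k)
  pLevel_bot := by rw [Nat.bot_eq_zero, pow_zero, rootsOfUnityFixer_one]
  pLevel_antitone _ _ h := rootsOfUnityFixer_le_of_dvd K (pow_dvd_pow p h)
  isOpen_pLevel k :=
    haveI : NeZero (p ^ k) := ⟨pow_ne_zero k (Fact.out : p.Prime).ne_zero⟩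
    isOpen_rootsOfUnityFixer K (p ^ k)
  commutator_le_pLevel k :=
    haveI : NeZero (p ^ k) := ⟨pow_ne_zero k (Fact.out : p.Prime).ne_zero⟩
    commutator_le_rootsOfUnityFixer K (p ^ k)
  pLevel_unramifiedAt k v hv :=
    haveI : NeZero (p ^ k) := ⟨pow_ne_zero k (Fact.out : p.Prime).ne_zero⟩
    rootsOfUnityFixer_unramifiedAt_of_not_mem K (p ^ k) (by
      rw [Nat.cast_pow]
      exact fun h ↦ hp v hv (v.isPrime.mem_of_pow_mem k h))
  tameLevel q := rootsOfUnityFixer K (ℓ q)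
  isOpen_tameLevel q :=
    haveI : NeZero (ℓ q) := ⟨hℓ q⟩
    isOpen_rootsOfUnityFixer K (ℓ q)
  commutator_le_tameLevel q :=
    haveI : NeZero (ℓ q) := ⟨hℓ q⟩
    commutator_le_rootsOfUnityFixer K (ℓ q)
  tameLevel_unramifiedAt q hq v hv hne :=
    haveI : NeZero (ℓ q) := ⟨hℓ q⟩
    rootsOfUnityFixer_unramifiedAt_of_not_mem K (ℓ q) (hℓv q hq v hv hne)

/-- The usable primes of `cyclotomicLevels`. [folklore] -/
@[simp]
theorem cyclotomicLevels_primes (ℓ : HeightOneSpectrum (𝓞 K) → ℕ)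
    (primes : Set (HeightOneSpectrum (𝓞 K))) (hℓ : ∀ q, ℓ q ≠ 0)
    (hp : ∀ v ∈ primes, (p : 𝓞 K) ∉ v.asIdeal)
    (hℓv : ∀ q ∈ primes, ∀ v ∈ primes, v ≠ q → (ℓ q : 𝓞 K) ∉ v.asIdeal) :
    (cyclotomicLevels K p ℓ primes hℓ hp hℓv).primes = primes :=
  rfl

/-- The levels of `cyclotomicLevels`: `level k r = Gal(K̄/K(μ_{p^k})) ⊓ ⨅_{q ∈ r} Gal(K̄/K(μ_{ℓ_q}))`.
[folklore] -/
theorem cyclotomicLevels_level (ℓ : HeightOneSpectrum (𝓞 K) → ℕ)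
    (primes : Set (HeightOneSpectrum (𝓞 K))) (hℓ : ∀ q, ℓ q ≠ 0)
    (hp : ∀ v ∈ primes, (p : 𝓞 K) ∉ v.asIdeal)
    (hℓv : ∀ q ∈ primes, ∀ v ∈ primes, v ≠ q → (ℓ q : 𝓞 K) ∉ v.asIdeal) (k : ℕ)
    (r : Finset (HeightOneSpectrum (𝓞 K))) :
    (cyclotomicLevels K p ℓ primes hℓ hp hℓv).level k r =
      rootsOfUnityFixer K (p ^ k) ⊓ ⨅ q ∈ r, rootsOfUnityFixer K (ℓ q) :=
  rfl

end Levels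

/-! ## The cyclotomic levels over `ℚ` -/

section Rat

open Rat.HeightOneSpectrum

variable (p : ℕ) [Fact p.Prime]

/-- For a finite place `v` of `ℚ` with rational prime `ℓ_v = primesEquiv v`, a natural number
`n` not divisible by `ℓ_v` does not lie in `v` (`v ∩ ℤ = ℓ_v ℤ`). [folklore] -/
theorem Rat.natCast_not_mem_asIdeal_of_not_dvd {n : ℕ} {v : HeightOneSpectrum (𝓞 ℚ)}
    (hn : ¬ ((primesEquiv v : Nat.Primes) : ℕ) ∣ n) : (n : 𝓞 ℚ) ∉ v.asIdeal := by
  intro hmem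
  apply hn
  have h2 := Ideal.mem_map_of_mem (Rat.IsIntegralClosure.intEquiv (𝓞 ℚ)) hmem
  rw [map_natCast] at h2
  exact (natGenerator_dvd_iff v).mpr h2

/-- **The cyclotomic levels over `ℚ`**: `K_∞`-direction `ℚ(μ_{p^k})`, tame level `ℚ(μ_ℓ)` at the
place `v = ℓ`, usable primes the places `v ∉ S` different from `p` (`S` the bad places, e.g.
the level of a modular form).  This is the tower `ℚ(μ_m)`, `m = p^k ℓ₁ ⋯ ℓ_s` with `ℓ_i ∉ S ∪ {p}`
distinct, on which the cyclotomic-unit Euler system (Rubin, Ch. III §2) and Kato's Euler system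
live (`𝒩 = {n p^k}` of Rubin's PCMI lectures §4.1).
Ref: Rubin, *Euler Systems* (2000), Ch. III §2.1; Def. 2.1.1, Remark 2.1.4. [cite: Rubin2000, Ch. III §2.1] -/
def cyclotomicLevelsRat (S : Set (HeightOneSpectrum (𝓞 ℚ))) : EulerSystemLevels ℚ ℕ :=
  cyclotomicLevels ℚ p (fun v ↦ ((primesEquiv v : Nat.Primes) : ℕ))
    {v | v ∉ S ∧ ((primesEquiv v : Nat.Primes) : ℕ) ≠ p}
    (fun v ↦ (primesEquiv v).2.ne_zero)
    (fun v hv ↦ Rat.natCast_not_mem_asIdeal_of_not_dvd fun h ↦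
      hv.2 ((Nat.prime_dvd_prime_iff_eq (primesEquiv v).2 Fact.out).mp h))
    (fun q _ v _ hne ↦ Rat.natCast_not_mem_asIdeal_of_not_dvd fun h ↦ hne (by
      have h' : ((primesEquiv v : Nat.Primes) : ℕ) = (primesEquiv q : Nat.Primes) :=
        (Nat.prime_dvd_prime_iff_eq (primesEquiv v).2 (primesEquiv q).2).mp h
      exact primesEquiv.injective (Subtype.ext h')))

/-- The usable primes of `cyclotomicLevelsRat p S`: the places `v ∉ S` with `v ≠ p`. [folklore] -/
@[simp]
theorem mem_cyclotomicLevelsRat_primes_iff (S : Set (HeightOneSpectrum (𝓞 ℚ)))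
    (v : HeightOneSpectrum (𝓞 ℚ)) :
    v ∈ (cyclotomicLevelsRat p S).primes ↔ v ∉ S ∧ ((primesEquiv v : Nat.Primes) : ℕ) ≠ p :=
  Iff.rfl

/-- The levels of `cyclotomicLevelsRat`: `Gal(ℚ̄/ℚ(μ_{p^k})) ⊓ ⨅_{ℓ ∈ r} Gal(ℚ̄/ℚ(μ_ℓ))`
(`= Gal(ℚ̄/ℚ(μ_m))`, `m = p^k ∏ ℓ`). [folklore] -/
theorem cyclotomicLevelsRat_level (S : Set (HeightOneSpectrum (𝓞 ℚ))) (k : ℕ)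
    (r : Finset (HeightOneSpectrum (𝓞 ℚ))) :
    (cyclotomicLevelsRat p S).level k r =
      rootsOfUnityFixer ℚ (p ^ k) ⊓ ⨅ q ∈ r, rootsOfUnityFixer ℚ ((primesEquiv q : Nat.Primes) : ℕ) :=
  rfl

end Rat

end Literature.NumberTheory.GaloisRepresentations

end
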